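/-
Copyright (c) 2026 the pub-hodgecm-mathlib formalisation cell (harness21).  Prover seat hodgecm-mathlib-LH4-p11 (g9), req620 Track A «(D-RAM) FOUR-FRAME» squad, helper lane on
h413 = stmt-HodgeConjecture-24833 (count-neutral).  β-BOARD v1 ROW R6a — THE ∀-CLOSED LATTICE SCHEMA `hK` of β chair F0P3a-p01 (g37)'s `hRest_of_heads` (LEDGER #20 (κ₁)),
discharged from the tower-1 κ-class stratum head (FILE E2).  2026-09-04.
-/
import Summits.HodgeConjecture.HodgeConjecture.Theorems.F0P3cDyRamLabelledOddKappaClassG1     -- ★ FILE E2 (this seat): `finsum_stratum_G1_kappaLocus_shell_labelledOdd_div_relIndex_eq` (the head `hκ₁`)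
import Summits.HodgeConjecture.HodgeConjecture.Theorems.F0P3cDyRamTowerSignToken             -- ★ p860771 (LH7 lineage): `exists_towerSign_of_mcOfRecord_le` (the token of `β − 1` at `n₁`)
import HarnessLib

/-!
# Crux `H413`, line LH4 «(D-RAM) FOUR-FRAME» — (β-BAL) Stage B, β-BOARD ROW R6a: THE SCHEMA `hK` (κ₁) OF `hRest_of_heads`, CLOSED

Cell `hodgecm-mathlib` (D-0151), FLOOR 0, crux item H413 = `stmt-HodgeConjecture-24833`, route `HCCMUnconditional`; squad F0∕P3c∕LH4.  THEOREMS ONLY (no `def`, no instance, no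
notation, no `sorry`, default heartbeats); ★-only imports; lane `--supports stmt-HodgeConjecture-24833 --as helper` (count-neutral); pays NO row, states NO law.

WHAT.  β chair F0P3a-p01 (g37)'s `F0P3cDyRamOddLabelledRestOfHeads.hRest_of_heads (hK) (hW) (hB) (hZ)` takes four ∀-closed lattice schemas; `hK` is the tower-1 κ-class value on the
κ-branch, quantified over the field, the datum, the element datum at `n0DerivedOfRecord d`, the frame `T = diag(α, β, 1)` and ONE token `e_A` of `α − 1` at `n₂`.  ★ FILE E2's head
`finsum_stratum_G1_kappaLocus_shell_labelledOdd_div_relIndex_eq` proves exactly that value from `e_A` AND a token `e_B` of `β − 1` at `n₁`; the value does not see `e_B`, and such a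
token exists in the derived regime (★ `exists_towerSign_of_mcOfRecord_le`: `β ∈ E¹`, `|β − 1| = |ϖ|^{n₁}`, `n₁ ≡ d % 2`, `mcOfRecord d ≤ n0DerivedOfRecord d ≤ n₁`).  Hence
**`kappaSchema_G1`**, whose TYPE is the `hK` binder of `hRest_of_heads` VERBATIM: `hRest_of_heads kappaSchema_G1 ‹hW› ‹hB› ‹hZ›`.
HONEST LABEL.  Count-neutral (`--supports`); nothing printed is asserted; the schemas `hW hB hZ`, hRest, (β) `stub_law_cleanSgn`, T₊ remain OPEN; `HC_CM` is proved only modulo the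
7 printed citations (2 remaining named inputs: hLiu418 = `stmt-HodgeConjecture-24832`, h413 = `stmt-HodgeConjecture-24833`) until rung 0 closes.
References: [Kottwitz1986BaseChangeUnits] §1 pp. 240–241 · [Rogawski1990] §4.9 Prop. 4.9.1 (a)(b) p. 55, §4.10 p. 58 · [LanglandsShelstad1987] §3 · [Serre1979] Ch. V §3, Ch. XV §2.
-/

set_option autoImplicit false

noncomputable section

namespace Summit.HodgeConjecture.HodgeConjecture.Cruxes.H413.F0P3cDyRamLabelledOddKappaClassG1Schema

open Matrix WithZero
open Literature.NumberTheory.Automorphic Literature.NumberTheory.Automorphic.HermitianLattice Literature.NumberTheory.Automorphic.UnitaryGroup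
open Literature.NumberTheory.Automorphic.UnitaryLatticeTree Literature.NumberTheory.Automorphic.UnitaryThreeFourFrame
open Literature.NumberTheory.LocalFields Literature.NumberTheory.LocalFields.WildQuadraticDatum
open Summit.HodgeConjecture.HodgeConjecture.Cruxes.H413.F0P3cDyRamFourFramePieces
open Summit.HodgeConjecture.HodgeConjecture.Cruxes.H413.F0P3cDyRamFourFrameCensusDefs
open Summit.HodgeConjecture.HodgeConjecture.Cruxes.H413.F0P3cDyRamStageOneBDefs (mcOfRecord)
open Summit.HodgeConjecture.HodgeConjecture.Cruxes.H413.F0P3cDyRamStageOneBDerivedDefs (n0DerivedOfRecord mcOfRecord_le_n0DerivedOfRecord)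
open Summit.HodgeConjecture.HodgeConjecture.Cruxes.H413.F0P3cDyRamDiagonalTorusDefs
open Summit.HodgeConjecture.HodgeConjecture.Cruxes.H413.F0P3cDyRamDiagonalStrataDefs
open Summit.HodgeConjecture.HodgeConjecture.Cruxes.H413.F0P3cDyRamDiagonalKappaCountDefs
open Summit.HodgeConjecture.HodgeConjecture.Cruxes.H413.F0P3cDyRamLabelledOddCountDefs
open Summit.HodgeConjecture.HodgeConjecture.Cruxes.H413.F0P3cDyRamElementDatumParity (depth_mod_two_eq_of_isElementDatum)
open Summit.HodgeConjecture.HodgeConjecture.Cruxes.H413.F0P3cDyRamTowerSignToken (exists_towerSign_of_mcOfRecord_le)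
open Summit.HodgeConjecture.HodgeConjecture.Cruxes.H413.F0P3cDyRamLabelledOddKappaClassG1 (finsum_stratum_G1_kappaLocus_shell_labelledOdd_div_relIndex_eq)
open scoped Valued WithZero Matrix MatrixGroups

/-- **β-BOARD R6a — THE SCHEMA `hK` (κ₁) OF `hRest_of_heads`, CLOSED**: for every complete discretely valued `K` with finite residue field, every ramified datum with `|2| < 1`, every element
datum at `n0DerivedOfRecord d`, `T = diag(α, β, 1)` and every token `e_A` of `α − 1` at `n₂`: on the κ-branch `2ρ + d%2 = n₂`, `2ρ + s + d%2 < n₁` (`ρ, s ≥ 1`, `2 ∣ s`),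
`Σᶠ_{G₁(ρ,s), shell} labelledOddCount σ ϖ 0 i Λ M ∕ [𝒰 : N(S̃′(M))] = (ω(e_A), 0, 0)_i ∕ 2 · q^{2ρ−1+s∕2} · ((q−1)·[2d + d%2 + 2ρ + s ≤ n₁] − [n₁ + 2 = 2d + d%2 + 2ρ + s])` — ★ FILE E2's head at
a token `e_B` of `β − 1` at `n₁` supplied by ★ `exists_towerSign_of_mcOfRecord_le`.  The type is `hRest_of_heads`'s `hK` binder VERBATIM. [cite: Kottwitz1986BaseChangeUnits, §1 pp. 240–241]
[cite: Rogawski1990, §4.9 Prop. 4.9.1 (a)(b) p. 55, §4.10 p. 58] [cite: LanglandsShelstad1987, §3] [cite: Serre1979, Ch. V §3, Ch. XV §2] -/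
theorem kappaSchema_G1 :
    ∀ {K : Type} [Field K] [Valued K ℤᵐ⁰] [CompleteSpace K] [Fintype 𝓀[K]] (σ : K →+* K) (ϖ : K) (d t : ℕ),
      Valued.v (2 : K) < 1 → IsRamifiedQuadraticDatum σ ϖ d t →
      ∀ (α β : K) (n₁ n₂ n₃ : ℕ), IsElementDatum σ ϖ (n0DerivedOfRecord d) α β n₁ n₂ n₃ →
      ∀ (T : GL (Fin 3) K), (T : Matrix (Fin 3) (Fin 3) K) = Matrix.diagonal ![α, β, 1] →
      ∀ {eA : K}, σ eA = eA → Valued.v eA = 1 → Valued.v ((ϖ ^ mstarOfRecord d)⁻¹ * ((α - 1) * ((ϖ * σ ϖ) ^ ((n₂ - d % 2) / 2))⁻¹ - eA * ((ϖ - σ ϖ) * ((ϖ * σ ϖ) ^ ((d - d % 2) / 2))⁻¹))) ≤ 1 →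
      ∀ (ρ s : ℕ), 1 ≤ ρ → 1 ≤ s → 2 ∣ s → 2 * ρ + d % 2 = n₂ → 2 * ρ + s + d % 2 < n₁ → ∀ i : Fin 3,
      ∑ᶠ M ∈ {M : Submodule 𝒪[K] (Fin 3 → K) | M ∈ stratum σ ϖ T ![2 * ρ, 2 * ρ + s, 2 * ρ + s] ∧
      (LatticeInLevel ϖ (d % 2) (Matrix.diagonal ![α - 1, β - 1, 0]) M ∧ ¬ LatticeInLevel ϖ (d % 2 + 1) (Matrix.diagonal ![α - 1, β - 1, 0]) M ∧
      LatticeInLevel ϖ (mcOfRecord d) (Matrix.diagonal ![(α - 1) * (α - 1), (β - 1) * (β - 1), 0]) M)},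
      (labelledOddCount σ ϖ 0 i (valueClassLabel σ ϖ (α - 1) (β - 1) (mstarOfRecord d) d) M : ℚ) /
      ((((unitStabilizer M).map (unitNormMap σ 3)).relIndex (fixedUnitTorus σ 3) : ℕ) : ℚ) =
      ((![normSign σ eA, 0, 0] : Fin 3 → ℤ) i : ℚ) / 2 * (Fintype.card 𝓀[K] : ℚ) ^ (2 * ρ - 1 + s / 2) *
      ((if 2 * d + d % 2 + 2 * ρ + s ≤ n₁ then (Fintype.card 𝓀[K] : ℚ) - 1 else 0) - (if n₁ + 2 = 2 * d + d % 2 + 2 * ρ + s then 1 else 0)) := by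
  intro K _ _ _ _ σ ϖ d t h2 hD α β n₁ n₂ n₃ hE T hT eA hσeA heA1 heA
  have hmcN : mcOfRecord d ≤ n0DerivedOfRecord d := mcOfRecord_le_n0DerivedOfRecord d
  have hmcv : mcOfRecord d = 2 * ((d % 2 + 2 * d - 1 + d) / 2) := rfl
  have hdN : d ≤ n0DerivedOfRecord d := by omega
  obtain ⟨-, hβ, -, -, -, h₁, -, -, hN1, -, -⟩ := id hE
  obtain ⟨hp1, -, -⟩ := depth_mod_two_eq_of_isElementDatum hD hE hdN
  obtain ⟨eB, hσeB, heB1, heB⟩ := exists_towerSign_of_mcOfRecord_le hD hβ h₁ hp1 (le_trans hmcN hN1)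
  exact finsum_stratum_G1_kappaLocus_shell_labelledOdd_div_relIndex_eq hD h2 hE T hT hσeA heA1 heA hσeB heB1 heB

end Summit.HodgeConjecture.HodgeConjecture.Cruxes.H413.F0P3cDyRamLabelledOddKappaClassG1Schema

end
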